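import Summits.HodgeConjecture.HodgeConjecture.Theorems.EndoscopicMiddleDegreeAlgebraicOrEnvelopedStubAlgebraicKernelSplit
import Summits.HodgeConjecture.HodgeConjecture.Theorems.EndoscopicMiddleDegreeCupProductAlgebraicOfChernCharacter
import Literature.AlgebraicGeometry.HodgeTheory.ComplexConjugationHolds
import Literature.NumberTheory.Transcendental.DeRhamTheoremMultiplicative
import Literature.AlgebraicGeometry.Motives.ComplexPointsOrientation
import Literature.AlgebraicTopology.SingularHomology.PoincareDualityProofs
import HarnessLib

/-!
# Route EndoscopicMiddleDegree · crux `AlgebraicOrEnveloped` (stmt-HodgeConjecture-14943) from its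
# residual — the closed composition of line `Sketch`, and the residue as Literature named facts

Helper file of the lead of line `Sketch` (crux workfile `Cruxes/AlgebraicOrEnveloped/Lines/Sketch.lean`),
`--supports stmt-HodgeConjecture-14943`. The crux (the dichotomy: for `m ∈ {1,2}`, a datum
`D : UnitaryBallQuotientDatum (2(m+1)) X` and HC in degree `2m` on `X`, every rational Hodge
`(m+1,m+1)`-class lies in `algebraicClasses X (m+1) ⊔ span_ℂ {enveloped rational classes}`) is reduced,
KERNEL-CHECKED, to

* its RESIDUAL `AlgebraicKernelEnveloped` — every rational Hodge `(m+1,m+1)`-class `e` that is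
  cup-orthogonal to ALL of `algebraicClasses X (m+1)` is enveloped (the crux's own clause: some
  algebraic `γ` on `X ⊗ X` whose action `P_γ = pr₁₊(pr₂^* · ∪ γ)` preserves rational classes, has purely
  `(m+1,m+1)` image and fixes `e`) — spelled out in tree vocabulary as the hypothesis `hres` below
  (it is the registered stub `stub_algebraicKernelEnveloped` verbatim), and
* three Literature named facts: the Kähler package `hardLefschetz_hodgeRiemann d Y` (Voisin I
  Thm. 6.25/6.32/7.10), Grothendieck's coniveau inclusion
  `Grothendieck1969_supportedClasses_le_hodgeConiveau`, and — through `CupProductAlgebraic`, support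
  item stmt-HodgeConjecture-14350, landed conditional proof `cupProductAlgebraic_of_span_chernCharacter`
  — `span_holomorphicBundleChernCharacter_eq_algebraicClasses` (Voisin I Thm. 11.32 ⊗ ℂ);

de Rham's theorem in multiplicative form and the existence of Hodge models, which the landed split
`stub_algebraicKernelSplit` (p99326) also consumes, being THEOREMS of the tree
(`exists_deRhamIsoFamily_holds`, `nonempty_hodgeModel_holds`).

Contents: `algebraicOrEnveloped_of_algebraicKernelEnveloped` (residual + Kähler package + coniveau +
`CupProductAlgebraic` ⟹ crux: split along the landed `stub_algebraicKernelSplit`, envelope each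
`Alg`-orthogonal generator, `Submodule.span_mono`), its named-fact form
`algebraicOrEnveloped_of_algebraicKernelEnveloped_of_facts`, the converse comparison
`algebraicKernelEnveloped_of_orthogonalEnveloped` (`CupProductAlgebraic` + crux #4 `OrthogonalEnveloped`
⟹ residual: the theta world consists of algebraic classes), whence
`algebraicOrEnveloped_of_orthogonalEnveloped_of_facts` (crux ⟸ #4 modulo the same three facts —
the content of the landed glue `algebraicOrEnvelopedOfSplit_proof` with `orthogonalSplit_of_grothendieck`,
re-derived here through the residual), and the
equivalence `algebraicOrEnveloped_iff_algOrthogonal` (modulo the facts the crux IS its restriction to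
the `Alg`-orthogonal = transcendental rational Hodge classes).
-/

noncomputable section

-- mandated namespace `Summit.HodgeConjecture.HodgeConjecture.Theorems` (single-problem summit: Problem =
-- Summit) trips `linter.dupNamespace`; off tree-wide in the lakefile, restated for stand-alone elaboration.
set_option linter.dupNamespace false

open CategoryTheory MonoidalCategory CartesianMonoidalCategory
open Literature.AlgebraicGeometry.Motives Literature.AlgebraicGeometry.HodgeTheory
open Literature.AlgebraicGeometry.ShimuraVarieties Literature.AlgebraicTopology.SingularHomology
open Summit.HodgeConjecture.HodgeConjecture.Theses.EndoscopicMiddleDegree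
open scoped Manifold

namespace Summit.HodgeConjecture.HodgeConjecture.Theorems

/-- **The crux `AlgebraicOrEnveloped` from its residual** (line `Sketch`, closed composition): granted
the Kähler package `hK`, Grothendieck's coniveau inclusion `hG` and `CupProductAlgebraic`, IF every
rational Hodge `(m+1,m+1)`-class cup-orthogonal to all algebraic classes is enveloped (`hres`, the
registered residual stub `stub_algebraicKernelEnveloped` verbatim, for every orientation family with
Poincaré duality), THEN the crux holds: a rational Hodge class splits along the landed
`stub_algebraicKernelSplit` (Hodge–Riemann: `Hdg_ℚ ⊆ Alg + span {rational Hodge e ⊥ Alg}`, de Rham's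
theorem supplied by `exists_deRhamIsoFamily_holds`) and each `Alg`-orthogonal generator is enveloped at
the complex orientation family. (The statement is the sub-goal registered on the crux item, printed on one
line verbatim: hypotheses `hK`, `hG`, `hcup`, `hres`, conclusion `AlgebraicOrEnveloped`.)
[cite: VoisinHodgeI2002, §6.3.2 Thm. 6.32 and §7.1.2] [cite: GrothendieckTopology1969, p. 299 (∗) and p. 300] -/
theorem algebraicOrEnveloped_of_algebraicKernelEnveloped : (∀ (d : ℕ) (Y : Literature.AlgebraicGeometry.Motives.SchemeOver ℂ), Literature.AlgebraicGeometry.HodgeTheory.hardLefschetz_hodgeRiemann d Y) → Literature.AlgebraicGeometry.HodgeTheory.Grothendieck1969_supportedClasses_le_hodgeConiveau → Summit.HodgeConjecture.HodgeConjecture.Theses.EndoscopicMiddleDegree.CupProductAlgebraic → (∀ (μ : Literature.AlgebraicGeometry.HodgeTheory.OrientationFamily), μ.HasPoincareDuality → ∀ (m : ℕ) (X : Literature.AlgebraicGeometry.Motives.SchemeOver ℂ) (D : Literature.AlgebraicGeometry.ShimuraVarieties.UnitaryBallQuotientDatum (2 * (m + 1)) X), 1 ≤ m → m ≤ 2 →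 (∀ a : Literature.AlgebraicGeometry.HodgeTheory.complexBetti X (2 * m), Literature.AlgebraicGeometry.HodgeTheory.IsRationalClass a → Literature.AlgebraicGeometry.HodgeTheory.IsOfHodgeType (2 * (m + 1)) X (2 * m) m m a → a ∈ Literature.AlgebraicGeometry.HodgeTheory.algebraicClasses X m) → ∀ e : Literature.AlgebraicGeometry.HodgeTheory.complexBetti X (2 * (m + 1)), Literature.AlgebraicGeometry.HodgeTheory.IsRationalClass e → Literature.AlgebraicGeometry.HodgeTheory.IsOfHodgeType (2 * (m + 1)) X (2 * (m + 1)) (m + 1) (m + 1) e → (∀ x ∈ Literature.AlgebraicGeometry.HodgeTheory.algebraicClasses X (m + 1), Literature.AlgebraicTopology.SingularHomology.cupProduct (Literature.AlgebraicGeometry.HodgeTheory.two_mul_add_two_mul (m + 1) (m + 1)) e x = 0) → ∃ γ ∈ Literature.AlgebraicGeometry.HodgeTheory.algebraicClasses (CategoryTheory.MonoidalCategoryStruct.tensorObj X X) (2 * (m + 1)), (∀ β, Literature.AlgebraicGeometry.HodgeTheory.IsRationalClass β → Literature.AlgebraicGeometry.HodgeTheory.IsRationalClass (Literature.AlgebraicGeometry.HodgeTheory.complexGysin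 μ (Literature.AlgebraicGeometry.Motives.IsSmoothProjective.tensor_holds D.isSmoothProjective D.isSmoothProjective) D.isSmoothProjective (CategoryTheory.CartesianMonoidalCategory.fst X X) (show 2 * (m + 1) + 2 * (2 * (m + 1)) + 2 * (2 * (m + 1)) = 2 * (m + 1) + 2 * (2 * (m + 1) + 2 * (m + 1)) by ring) (Literature.AlgebraicTopology.SingularHomology.cupProduct (rfl : 2 * (m + 1) + 2 * (2 * (m + 1)) = 2 * (m + 1) + 2 * (2 * (m + 1))) (Literature.AlgebraicGeometry.HodgeTheory.complexBetti.map (CategoryTheory.CartesianMonoidalCategory.snd X X) (2 * (m + 1)) β) γ))) ∧ (∀ β, Literature.AlgebraicGeometry.HodgeTheory.IsOfHodgeType (2 * (m + 1)) X (2 * (m + 1)) (m + 1) (m + 1) (Literature.AlgebraicGeometry.HodgeTheory.complexGysin μ (Literature.AlgebraicGeometry.Motives.IsSmoothProjective.tensor_holds D.isSmoothProjective D.isSmoothProjective) D.isSmoothProjective (CategoryTheory.CartesianMonoidalCategory.fst X X) (show 2 * (m + 1) + 2 * (2 * (m + 1)) + 2 * (2 * (m + 1)) = 2 * (m + 1)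 + 2 * (2 * (m + 1) + 2 * (m + 1)) by ring) (Literature.AlgebraicTopology.SingularHomology.cupProduct (rfl : 2 * (m + 1) + 2 * (2 * (m + 1)) = 2 * (m + 1) + 2 * (2 * (m + 1))) (Literature.AlgebraicGeometry.HodgeTheory.complexBetti.map (CategoryTheory.CartesianMonoidalCategory.snd X X) (2 * (m + 1)) β) γ))) ∧ (Literature.AlgebraicGeometry.HodgeTheory.complexGysin μ (Literature.AlgebraicGeometry.Motives.IsSmoothProjective.tensor_holds D.isSmoothProjective D.isSmoothProjective) D.isSmoothProjective (CategoryTheory.CartesianMonoidalCategory.fst X X) (show 2 * (m + 1) + 2 * (2 * (m + 1)) + 2 * (2 * (m + 1)) = 2 * (m + 1) + 2 * (2 * (m + 1) + 2 * (m + 1)) by ring) (Literature.AlgebraicTopology.SingularHomology.cupProduct (rfl : 2 * (m + 1) + 2 * (2 * (m + 1)) = 2 * (m + 1) + 2 * (2 * (m + 1))) (Literature.AlgebraicGeometry.HodgeTheory.complexBetti.map (CategoryTheory.CartesianMonoidalCategory.snd X X) (2 * (m + 1)) e) γ)) = e) → Summit.HodgeConjecture.HodgeConjecture.Theses.EndoscopicMiddleDegree.AlgebraicOrEnveloped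 := by
  intro hK hG hcup hres m X D hm1 hm2 hlow c hc hH
  -- the complex orientation family, with Poincaré duality (Hatcher Thm. 3.30)
  obtain ⟨μ, hμ⟩ : ∃ μ : OrientationFamily, μ.HasPoincareDuality :=
    ⟨fun _ _ h ↦ Classical.choice (ComplexPoints.isOrientableOver ℂ h),
      OrientationFamily.hasPoincareDuality_of (fun ν _ _ h ↦ poincare_duality ν h) _⟩
  refine SetLike.le_def.1 (sup_le_sup_left (Submodule.span_mono ?_) _)
    (stub_algebraicKernelSplit hK hG
      (fun E _ _ _ ↦ Literature.NumberTheory.Transcendental.exists_deRhamIsoFamily_holds E)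
      hcup m X D hm1 hm2 hlow c hc hH)
  rintro e ⟨he, heH, horth⟩
  obtain ⟨γ, hγ, hrat, hhodge, hfix⟩ := hres μ hμ m X D hm1 hm2 hlow e he heH horth
  exact ⟨he, μ, hμ, γ, hγ, hrat, hhodge, hfix⟩

/-- **The crux from its residual and THREE Literature named facts**: as
`algebraicOrEnveloped_of_algebraicKernelEnveloped`, with `CupProductAlgebraic` supplied by the landed
`cupProductAlgebraic_of_span_chernCharacter` from `span_holomorphicBundleChernCharacter_eq_algebraicClasses`
(Voisin I Thm. 11.32 ⊗ ℂ) and the theorem `nonempty_hodgeModel_holds`. This is the exact residue of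
the crux along line `Sketch`: `hardLefschetz_hodgeRiemann`, `Grothendieck1969_supportedClasses_le_hodgeConiveau`,
`span_holomorphicBundleChernCharacter_eq_algebraicClasses`, and the residual.
[cite: VoisinHodgeI2002, Thm. 6.32, §7.1.2 and Thm. 11.32] [cite: VoisinHodgeII2003, Prop. 9.20] -/
theorem algebraicOrEnveloped_of_algebraicKernelEnveloped_of_facts
    (hK : ∀ (d : ℕ) (Y : SchemeOver ℂ),
      Literature.AlgebraicGeometry.HodgeTheory.hardLefschetz_hodgeRiemann d Y)
    (hG : Grothendieck1969_supportedClasses_le_hodgeConiveau)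
    (hCh : span_holomorphicBundleChernCharacter_eq_algebraicClasses)
    (hres : ∀ (μ : OrientationFamily), μ.HasPoincareDuality →
      ∀ (m : ℕ) (X : SchemeOver ℂ) (D : UnitaryBallQuotientDatum (2 * (m + 1)) X), 1 ≤ m → m ≤ 2 →
      (∀ a : complexBetti X (2 * m), IsRationalClass a →
        IsOfHodgeType (2 * (m + 1)) X (2 * m) m m a → a ∈ algebraicClasses X m) →
      ∀ e : complexBetti X (2 * (m + 1)), IsRationalClass e →
        IsOfHodgeType (2 * (m + 1)) X (2 * (m + 1)) (m + 1) (m + 1) e →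
        (∀ x ∈ algebraicClasses X (m + 1),
          cupProduct (two_mul_add_two_mul (m + 1) (m + 1)) e x = 0) →
        ∃ γ ∈ algebraicClasses (X ⊗ X) (2 * (m + 1)),
          (∀ β, IsRationalClass β → IsRationalClass
            (complexGysin μ
              (IsSmoothProjective.tensor_holds D.isSmoothProjective D.isSmoothProjective)
              D.isSmoothProjective (fst X X)
              (show 2 * (m + 1) + 2 * (2 * (m + 1)) + 2 * (2 * (m + 1)) =
                2 * (m + 1) + 2 * (2 * (m + 1) + 2 * (m + 1)) by ring)
              (cupProduct (rfl : 2 * (m + 1) + 2 * (2 * (m + 1)) = 2 * (m + 1) + 2 * (2 * (m + 1)))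
                (complexBetti.map (snd X X) (2 * (m + 1)) β) γ))) ∧
          (∀ β, IsOfHodgeType (2 * (m + 1)) X (2 * (m + 1)) (m + 1) (m + 1)
            (complexGysin μ
              (IsSmoothProjective.tensor_holds D.isSmoothProjective D.isSmoothProjective)
              D.isSmoothProjective (fst X X)
              (show 2 * (m + 1) + 2 * (2 * (m + 1)) + 2 * (2 * (m + 1)) =
                2 * (m + 1) + 2 * (2 * (m + 1) + 2 * (m + 1)) by ring)
              (cupProduct (rfl : 2 * (m + 1) + 2 * (2 * (m + 1)) = 2 * (m + 1) + 2 * (2 * (m + 1)))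
                (complexBetti.map (snd X X) (2 * (m + 1)) β) γ))) ∧
          (complexGysin μ
              (IsSmoothProjective.tensor_holds D.isSmoothProjective D.isSmoothProjective)
              D.isSmoothProjective (fst X X)
              (show 2 * (m + 1) + 2 * (2 * (m + 1)) + 2 * (2 * (m + 1)) =
                2 * (m + 1) + 2 * (2 * (m + 1) + 2 * (m + 1)) by ring)
              (cupProduct (rfl : 2 * (m + 1) + 2 * (2 * (m + 1)) = 2 * (m + 1) + 2 * (2 * (m + 1)))
                (complexBetti.map (snd X X) (2 * (m + 1)) e) γ)) = e) :
    AlgebraicOrEnveloped :=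
  algebraicOrEnveloped_of_algebraicKernelEnveloped hK hG
    (EndoscopicMiddleDegree.cupProductAlgebraic_of_span_chernCharacter hCh
      fun _ _ ↦ nonempty_hodgeModel_holds) hres

/-- **`OrthogonalEnveloped` (crux #4) ⟹ the residual**, given `CupProductAlgebraic` for the Lefschetz
summand: the theta world `TW(D)` of `OrthogonalEnveloped` consists of ALGEBRAIC classes — special
cycle classes and cycles-on-special-cycles are supported in codimension `≥ m+1`
(`classesSupportedOn_le_supportedClasses` with the datum's closedness / codimension fields), the
Lefschetz summand `a ∪ d` is algebraic by the degree-`2m` hypothesis and `CupProductAlgebraic` — so a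
class cup-orthogonal to all algebraic classes is cup-orthogonal to `TW(D)`, and `OrthogonalEnveloped`
envelopes it. Hence the residual is the weakest typed form of the route's automorphic heart.
[cite: GrothendieckTopology1969, p. 300] -/
theorem algebraicKernelEnveloped_of_orthogonalEnveloped (hcup : CupProductAlgebraic)
    (h : OrthogonalEnveloped) :
    ∀ (μ : OrientationFamily), μ.HasPoincareDuality →
      ∀ (m : ℕ) (X : SchemeOver ℂ) (D : UnitaryBallQuotientDatum (2 * (m + 1)) X), 1 ≤ m → m ≤ 2 →
      (∀ a : complexBetti X (2 * m), IsRationalClass a →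
        IsOfHodgeType (2 * (m + 1)) X (2 * m) m m a → a ∈ algebraicClasses X m) →
      ∀ e : complexBetti X (2 * (m + 1)), IsRationalClass e →
        IsOfHodgeType (2 * (m + 1)) X (2 * (m + 1)) (m + 1) (m + 1) e →
        (∀ x ∈ algebraicClasses X (m + 1),
          cupProduct (two_mul_add_two_mul (m + 1) (m + 1)) e x = 0) →
        ∃ γ ∈ algebraicClasses (X ⊗ X) (2 * (m + 1)),
          (∀ β, IsRationalClass β → IsRationalClass
            (complexGysin μ
              (IsSmoothProjective.tensor_holds D.isSmoothProjective D.isSmoothProjective)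
              D.isSmoothProjective (fst X X)
              (show 2 * (m + 1) + 2 * (2 * (m + 1)) + 2 * (2 * (m + 1)) =
                2 * (m + 1) + 2 * (2 * (m + 1) + 2 * (m + 1)) by ring)
              (cupProduct (rfl : 2 * (m + 1) + 2 * (2 * (m + 1)) = 2 * (m + 1) + 2 * (2 * (m + 1)))
                (complexBetti.map (snd X X) (2 * (m + 1)) β) γ))) ∧
          (∀ β, IsOfHodgeType (2 * (m + 1)) X (2 * (m + 1)) (m + 1) (m + 1)
            (complexGysin μ
              (IsSmoothProjective.tensor_holds D.isSmoothProjective D.isSmoothProjective)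
              D.isSmoothProjective (fst X X)
              (show 2 * (m + 1) + 2 * (2 * (m + 1)) + 2 * (2 * (m + 1)) =
                2 * (m + 1) + 2 * (2 * (m + 1) + 2 * (m + 1)) by ring)
              (cupProduct (rfl : 2 * (m + 1) + 2 * (2 * (m + 1)) = 2 * (m + 1) + 2 * (2 * (m + 1)))
                (complexBetti.map (snd X X) (2 * (m + 1)) β) γ))) ∧
          (complexGysin μ
              (IsSmoothProjective.tensor_holds D.isSmoothProjective D.isSmoothProjective)
              D.isSmoothProjective (fst X X)
              (show 2 * (m + 1) + 2 * (2 * (m + 1)) + 2 * (2 * (m + 1)) =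
                2 * (m + 1) + 2 * (2 * (m + 1) + 2 * (m + 1)) by ring)
              (cupProduct (rfl : 2 * (m + 1) + 2 * (2 * (m + 1)) = 2 * (m + 1) + 2 * (2 * (m + 1)))
                (complexBetti.map (snd X X) (2 * (m + 1)) e) γ)) = e := by
  intro μ hμ m X D hm1 hm2 hlow e he heH horth
  have hX : IsSmoothProjective (2 * (m + 1)) X := D.isSmoothProjective
  have hTW : ((⨆ (W : Submodule D.E (Fin (2 * (m + 1) + 1) → D.E))
      (_ : IsTotallyPositive (conjRingHom D.E) D.H W) (_ : Module.finrank D.E W = m + 1),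
      classesSupportedOn X (D.specialSubvariety W) (2 * (m + 1))) ⊔
    (⨆ (W : Submodule D.E (Fin (2 * (m + 1) + 1) → D.E))
      (_ : IsTotallyPositive (conjRingHom D.E) D.H W) (_ : Module.finrank D.E W = m)
      (Z : Set X.left) (_ : IsClosed Z) (_ : Z ⊆ D.specialSubvariety W)
      (_ : ∀ z ∈ Z, ((m + 1 : ℕ) : ℕ∞) ≤ Order.coheight z),
      classesSupportedOn X Z (2 * (m + 1))) ⊔
    Submodule.span ℂ {z : complexBetti X (2 * (m + 1)) |
      ∃ a : complexBetti X (2 * m), IsRationalClass a ∧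
        IsOfHodgeType (2 * (m + 1)) X (2 * m) m m a ∧ ∃ d ∈ algebraicClasses X 1,
          z = cupProduct (two_mul_add_two_mul m 1) a d}) ≤ algebraicClasses X (m + 1) := by
    refine sup_le (sup_le ?_ ?_) ?_
    · refine iSup_le fun W ↦ iSup_le fun hW ↦ iSup_le fun hk ↦
        classesSupportedOn_le_supportedClasses (D.isClosed_specialSubvariety W hW) (fun z hz ↦ ?_) _
      have := D.le_coheight_of_mem_specialSubvariety W hW z hz
      rw [hk] at this
      exact_mod_cast this
    · exact iSup_le fun _ ↦ iSup_le fun _ ↦ iSup_le fun _ ↦ iSup_le fun _ ↦ iSup_le fun hZ ↦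
        iSup_le fun _ ↦ iSup_le fun hk ↦ classesSupportedOn_le_supportedClasses hZ hk _
    · refine Submodule.span_le.2 ?_
      rintro z ⟨a, ha, haH, d, hd, rfl⟩
      exact hcup hX m 1 a d (hlow a ha haH) hd
  obtain ⟨γ, hγ, hrat, hhodge, hfix⟩ :=
    h μ hμ m X D hm1 hm2 e he heH (fun x hx ↦ horth x (hTW hx))
  exact ⟨γ, hγ, hrat, hhodge, hfix⟩

/-- **The crux from crux #4 `OrthogonalEnveloped` and the three Literature named facts** (for the
record: the same residue as through the glue `AlgebraicOrEnvelopedOfSplit` + `orthogonalSplit_of_grothendieck`,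
here through the residual): `OrthogonalEnveloped ⟹ residual ⟹ crux`, `CupProductAlgebraic` from
`span_holomorphicBundleChernCharacter_eq_algebraicClasses` and `nonempty_hodgeModel_holds`.
[cite: VoisinHodgeI2002, Thm. 6.32, §7.1.2 and Thm. 11.32] [cite: GrothendieckTopology1969, p. 300] -/
theorem algebraicOrEnveloped_of_orthogonalEnveloped_of_facts
    (hK : ∀ (d : ℕ) (Y : SchemeOver ℂ),
      Literature.AlgebraicGeometry.HodgeTheory.hardLefschetz_hodgeRiemann d Y)
    (hG : Grothendieck1969_supportedClasses_le_hodgeConiveau)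
    (hCh : span_holomorphicBundleChernCharacter_eq_algebraicClasses)
    (h : OrthogonalEnveloped) : AlgebraicOrEnveloped :=
  have hcup : CupProductAlgebraic :=
    EndoscopicMiddleDegree.cupProductAlgebraic_of_span_chernCharacter hCh
      fun _ _ ↦ nonempty_hodgeModel_holds
  algebraicOrEnveloped_of_algebraicKernelEnveloped hK hG hcup
    (algebraicKernelEnveloped_of_orthogonalEnveloped hcup h)

/-- **Modulo the facts, the crux IS its transcendental part**: granted the Kähler package,
Grothendieck's coniveau inclusion and `CupProductAlgebraic`, `AlgebraicOrEnveloped` is equivalent to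
its restriction to the rational Hodge `(m+1,m+1)`-classes cup-orthogonal to all algebraic classes
(`→`: specialise; `←`: split along the landed `stub_algebraicKernelSplit` and apply the restricted
statement to each generator, `Submodule.span_le`). [cite: VoisinHodgeI2002, §6.3.2 Thm. 6.32 and §7.1.2] -/
theorem algebraicOrEnveloped_iff_algOrthogonal
    (hK : ∀ (d : ℕ) (Y : SchemeOver ℂ),
      Literature.AlgebraicGeometry.HodgeTheory.hardLefschetz_hodgeRiemann d Y)
    (hG : Grothendieck1969_supportedClasses_le_hodgeConiveau)
    (hcup : CupProductAlgebraic) :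
    AlgebraicOrEnveloped ↔
      ∀ (m : ℕ) (X : SchemeOver ℂ) (D : UnitaryBallQuotientDatum (2 * (m + 1)) X), 1 ≤ m → m ≤ 2 →
      (∀ a : complexBetti X (2 * m), IsRationalClass a →
        IsOfHodgeType (2 * (m + 1)) X (2 * m) m m a → a ∈ algebraicClasses X m) →
      ∀ e : complexBetti X (2 * (m + 1)), IsRationalClass e →
        IsOfHodgeType (2 * (m + 1)) X (2 * (m + 1)) (m + 1) (m + 1) e →
        (∀ x ∈ algebraicClasses X (m + 1),
          cupProduct (two_mul_add_two_mul (m + 1) (m + 1)) e x = 0) →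
        e ∈ algebraicClasses X (m + 1) ⊔ Submodule.span ℂ {e : complexBetti X (2 * (m + 1)) |
          IsRationalClass e ∧ ∃ μ : OrientationFamily, μ.HasPoincareDuality ∧
          ∃ γ ∈ algebraicClasses (X ⊗ X) (2 * (m + 1)),
          let P : complexBetti X (2 * (m + 1)) → complexBetti X (2 * (m + 1)) := fun β =>
            complexGysin μ
              (IsSmoothProjective.tensor_holds D.isSmoothProjective D.isSmoothProjective)
              D.isSmoothProjective (fst X X)
              (show 2 * (m + 1) + 2 * (2 * (m + 1)) + 2 * (2 * (m + 1)) =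
                2 * (m + 1) + 2 * (2 * (m + 1) + 2 * (m + 1)) by ring)
              (cupProduct (rfl : 2 * (m + 1) + 2 * (2 * (m + 1)) = 2 * (m + 1) + 2 * (2 * (m + 1)))
                (complexBetti.map (snd X X) (2 * (m + 1)) β) γ);
          (∀ β, IsRationalClass β → IsRationalClass (P β)) ∧
          (∀ β, IsOfHodgeType (2 * (m + 1)) X (2 * (m + 1)) (m + 1) (m + 1) (P β)) ∧ P e = e} := by
  constructor
  · intro h m X D hm1 hm2 hlow e he heH _
    exact h m X D hm1 hm2 hlow e he heH
  · intro h m X D hm1 hm2 hlow c hc hH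
    have hsplit := stub_algebraicKernelSplit hK hG
      (fun E _ _ _ ↦ Literature.NumberTheory.Transcendental.exists_deRhamIsoFamily_holds E)
      hcup m X D hm1 hm2 hlow c hc hH
    refine SetLike.le_def.1 ?_ hsplit
    refine sup_le le_sup_left (Submodule.span_le.2 ?_)
    rintro e ⟨he, heH, horth⟩
    exact h m X D hm1 hm2 hlow e he heH horth

end Summit.HodgeConjecture.HodgeConjecture.Theorems

end
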